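import Summits.ABC.IUTFork.Joshi.LocalPeriodRings
import Literature.RingTheory.GaloisAlgebras.CharacterModuleTorusSplitting
import HarnessLib

/-!
# [J-III] §5.2.5 «`B ⊗_{ℚ_p} E_0 = B ⊕ ··· ⊕ B`» — DISCHARGE of (5.2.5.3) over slot T-09's typed signature, and the
# free-module clause of (5.2.5.4)

Block E (rung LADDER-ABC:A2.E) of the abc-iut cell; seat abc-iut-E-t58 (batch 3, DISCHARGER class of the batch-3 slot book,
E-plan-2 2026-08-26T07:46:39Z); PROOF-ONLY companion of abc-iut-E-t9's landed SIGNATURE file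
`Summits/ABC/IUTFork/Joshi/LocalPeriodRings.lean` (p429989; K. Joshi, *Construction of Arithmetic Teichmüller Spaces III*,
arXiv:2401.13508v4 = [J-III], bib `Joshi2024ATS3`, §5.1–§5.2, PDF pp. 38–40 of the cell's render
`HOME/lit/renders/Joshi-arxiv-2401.13508/pNNNN.txt`, «p.N l.M» = line M of PDF page N). DEFS-FREEZE respected: nothing of
the signature file is re-declared; no `def … : Prop`, no new `Prop` fact, no instance, no axiom; 0 `sorry`. TAKES NO SIDE on
[IUTchIII] Cor. 3.12, on Joshi's claims (unrefereed preprint «Preliminary version for comments») or on Mochizuki's report on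
them; typed ≠ proved ≠ endorsed; «discharged» = OUR kernel check of OUR typed sentence, nothing more.

## What is proved

* **J3:(5.2.5.3)** p.40 l.1–5 «since `B` is also an `E_0` algebra, `B ⊗_{ℚ_p} E_0 = B ⊕ ··· ⊕ B` (`[E_0:ℚ_p]` factors)» — the
  claim-`Prop` `ATS3.PeriodRingTower.BEDatum.BtildeE0Splits` (`Nonempty ((B ⊗[ℚ_[p]] E_0) ≃ₐ[ℚ_[p]] (Fin f → B))`,
  `f = [E_0 : ℚ_p]`) HOLDS **under the Mathlib class hypothesis `[IsGalois ℚ_[p] ℰ.E0]`** (`btildeE0Splits_of_isGalois`). The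
  `E_0`-algebra structure on `B` that print invokes (§5.2.1 p.39 l.9–12 «Hence `B` and `B⁺` are `E_0`-algebras … This remark
  will be used in what follows») is CONSTRUCTED from the signature's fields `E0_subset_Bplus` («`E_0 ⊂ B⁺` inside `B_dR`»)
  and `toBdR_injective` (`exists_e0ToB`); the splitting is the tree's Galois splitting
  `Literature.RingTheory.GaloisAlgebras.CharacterModuleTorus.splitEquivOver` (`L ⊗_k R ≅ ∏_{Gal(L/k)} R` for `L/k` finite
  Galois and `R` an `L`-algebra; [Serre, *Local Fields*, Ch. X §1 Prop. 3]) re-indexed by `Gal(E_0/ℚ_p) ≃ Fin [E_0:ℚ_p]`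
  (`IsGalois.card_aut_eq_finrank`); canonical form `exists_btildeE0Equiv_gal` (`b ⊗ l ↦ (σ(l)·b)_σ`). PROOF-ONLY: 0 `def`s.
* **J3:(5.2.5.4), last clause** p.40 l.11–13 «`B̃_E = B ⊗_{ℚ_p} E` is naturally a finite and free `B`-module» — PROVED
  outright (base change of the finite free `ℚ_p`-module `E`): `btilde_free`, `btilde_finite`, `finrank_btilde`
  (`rank_B B̃_E = [E : ℚ_p]`).

## Faithfulness flag (for the referee lanes E-ref / aud; located, not adjudicated)

Print (§5.2.3 p.39 l.29–34) takes `E_0 ⊂ E` to be «its MAXIMAL UNRAMIFIED subfield», hence `E_0/ℚ_p` is (cyclic) Galois and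
(5.2.5.3) is the standard splitting. The typed signature `BEDatum` carries `E_0` only as DATA (`E0 : IntermediateField ℚ_[p] Ω`
with `E0 ≤ E` and `E_0 ⊂ B⁺`); «unramified» is not typed (the signature's own docstring says so). For an ARBITRARY
intermediate field `E_0 ≤ E` the sentence (5.2.5.3) is not a theorem (e.g. a non-normal cubic `E_0` inside a field `B ⊃ E_0`
containing no other root of its defining polynomial gives `B ⊗_{ℚ_p} E_0 ≅ B × (a field)`, not `B³`), so the discharge is
stated MODULO `[IsGalois ℚ_[p] ℰ.E0]` — a Mathlib class, not a named `Prop` fact. The full (5.2.5.4)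
`BtildeSplits` («`B̃_E = B_E ⊕ ··· ⊕ B_E`») additionally needs Lemma 5.2.3.1 (`BELinDisjoint`, cited [FF18, Prop. 1.6.9]) AND
an identification of the `f` Galois-TWISTED copies `B_σ ⊗_{E_0} E` (`σ ∈ Gal(E_0/ℚ_p)`) with `B_E` — in [FF18] supplied by
the Frobenius of `B` restricting to the Frobenius of `E_0 = W(k_E)[1/p]`, a compatibility the signature does not carry
(`frobB` is an abstract `ℚ_p`-automorphism of `B`); it is therefore NOT discharged here and no hypothesis is smuggled for it.

bears_on: LADDER-ABC:A2.E. [claim: Joshi2024ATS3, status: disputed]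
-/

noncomputable section

open scoped TensorProduct

namespace Summit.ABC.IUTFork.Joshi.ATS3

namespace PeriodRingTower

namespace BEDatum

variable {F B E0 : Type} [Field F] [CommRing B] [Field E0] {Y : Type} {K : Y → Type} [∀ y, Field (K y)]
  {G : Type} [Group G] {D : PeriodRingDatum F B E0 Y K G} {p : ℕ} [Fact p.Prime] [Algebra ℚ_[p] B]
  {Ω : Type} [Field Ω] [Algebra ℚ_[p] Ω] {T : PeriodRingTower D p Ω} (ℰ : T.BEDatum)

/-! ## 1. `B` is an `E_0`-algebra (§5.2.1 p.39 l.9–12), constructed from `E_0 ⊂ B⁺ ⊂ B ↪ B_dR` -/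

/-- **`E_0 → B`** (§5.2.1 «`B` and `B⁺` are `E_0`-algebras … This remark will be used in what follows»): there is a
`ℚ_p`-algebra map `E_0 → B` which, composed with `B ↪ B_dR`, is the inclusion `E_0 ⊂ B_dR` — obtained by inverting the
injection `toBdR` on `E_0 ⊂ B` (fields `E0_subset_Bplus`, `toBdR_injective` of the signature). PROVED (0 defs: the map is
exhibited inside the proof). [claim: Joshi2024ATS3, status: disputed] -/
theorem exists_e0ToB : ∃ φ : ℰ.E0 →ₐ[ℚ_[p]] B, ∀ x : ℰ.E0, T.toBdR (φ x) = (x : Ω) := by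
  let ι : ℰ.E0 →ₐ[ℚ_[p]] T.toBdR.range := AlgHom.codRestrict ℰ.E0.val T.toBdR.range fun x => ℰ.E0_le_range x.2
  let e := AlgEquiv.ofInjective T.toBdR T.toBdR_injective
  refine ⟨(e.symm : T.toBdR.range →ₐ[ℚ_[p]] B).comp ι, fun x => ?_⟩
  have h : ((e (e.symm (ι x)) : T.toBdR.range) : Ω) = (ι x : Ω) := by rw [AlgEquiv.apply_symm_apply]
  rw [AlgEquiv.ofInjective_apply] at h
  exact h

/-- `[E_0 : ℚ_p] < ∞` (as `E_0 ≤ E` and `[E : ℚ_p] < ∞`). [folklore] -/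
theorem finiteDimensional_E0 : FiniteDimensional ℚ_[p] ℰ.E0 := by
  haveI := ℰ.finiteDimensional
  exact FiniteDimensional.of_injective (IntermediateField.inclusion ℰ.E0_le).toLinearMap
    (IntermediateField.inclusion_injective ℰ.E0_le)

/-- `|Gal(E_0/ℚ_p)| = [E_0 : ℚ_p] = f` for `E_0/ℚ_p` Galois. [folklore] -/
theorem card_gal_E0 [IsGalois ℚ_[p] ℰ.E0] : Nat.card (ℰ.E0 ≃ₐ[ℚ_[p]] ℰ.E0) = ℰ.f := by
  haveI := ℰ.finiteDimensional_E0
  exact IsGalois.card_aut_eq_finrank ℚ_[p] ℰ.E0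

/-! ## 2. (5.2.5.3): `B ⊗_{ℚ_p} E_0 ≅ B^{[E_0:ℚ_p]}` for `E_0/ℚ_p` Galois -/

/-- **The canonical form of (5.2.5.3)**: for `E_0/ℚ_p` Galois there is a `ℚ_p`-algebra isomorphism
`B ⊗_{ℚ_p} E_0 ≅ ∏_{σ ∈ Gal(E_0/ℚ_p)} B` with `b ⊗ l ↦ (σ(l)·b)_σ` (read in `B_dR`: `σ(l) ∈ E_0 ⊂ B`) — the tree's
Galois splitting `Literature.RingTheory.GaloisAlgebras.CharacterModuleTorus.splitEquivOver` over the `E_0`-algebra `B` of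
§1. PROVED. [cite: SerreLocalFields1979, Ch. X §1 Prop. 3] -/
theorem exists_btildeE0Equiv_gal [IsGalois ℚ_[p] ℰ.E0] :
    ∃ e : (B ⊗[ℚ_[p]] ℰ.E0) ≃ₐ[ℚ_[p]] ((ℰ.E0 ≃ₐ[ℚ_[p]] ℰ.E0) → B),
      ∀ (b : B) (l : ℰ.E0) (σ : ℰ.E0 ≃ₐ[ℚ_[p]] ℰ.E0), T.toBdR (e (b ⊗ₜ l) σ) = (σ l : Ω) * T.toBdR b := by
  obtain ⟨φ, hφ⟩ := ℰ.exists_e0ToB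
  letI : Algebra ℰ.E0 B := φ.toRingHom.toAlgebra
  haveI : IsScalarTower ℚ_[p] ℰ.E0 B := IsScalarTower.of_algebraMap_eq fun r => by
    change algebraMap ℚ_[p] B r = φ (algebraMap ℚ_[p] ℰ.E0 r)
    rw [AlgHom.commutes]
  haveI := ℰ.finiteDimensional_E0
  refine ⟨(Algebra.TensorProduct.comm ℚ_[p] B ℰ.E0).trans
    (Literature.RingTheory.GaloisAlgebras.CharacterModuleTorus.splitEquivOver ℚ_[p] ℰ.E0 B), fun b l σ => ?_⟩
  simp only [AlgEquiv.trans_apply, Algebra.TensorProduct.comm_tmul,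
    Literature.RingTheory.GaloisAlgebras.CharacterModuleTorus.splitEquivOver_apply,
    Literature.RingTheory.GaloisAlgebras.CharacterModuleTorus.splitHomOver_tmul, map_mul]
  exact congrArg (· * T.toBdR b) (hφ (σ l))

/-- **J3:(5.2.5.3) DISCHARGED modulo `[IsGalois ℚ_[p] E_0]`** (p.40 l.1–5 «`B ⊗_{ℚ_p} E_0 = B ⊕ ··· ⊕ B` (`[E_0:ℚ_p]`
factors)»): the claim-`Prop` `BtildeE0Splits` of the signature file HOLDS whenever `E_0/ℚ_p` is Galois — which print's
«maximal unramified subfield» is (re-index `Gal(E_0/ℚ_p) ≃ Fin f` by `card_gal_E0`). FQ type.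
[claim: Joshi2024ATS3, status: disputed] -/
theorem btildeE0Splits_of_isGalois [IsGalois ℚ_[p] ℰ.E0] :
    Summit.ABC.IUTFork.Joshi.ATS3.PeriodRingTower.BEDatum.BtildeE0Splits ℰ := by
  obtain ⟨e, -⟩ := ℰ.exists_btildeE0Equiv_gal
  haveI := ℰ.finiteDimensional_E0
  let ν : (ℰ.E0 ≃ₐ[ℚ_[p]] ℰ.E0) ≃ Fin ℰ.f := (Finite.equivFin _).trans (finCongr ℰ.card_gal_E0)
  exact ⟨e.trans (AlgEquiv.piCongrLeft' ℚ_[p] (fun _ : ℰ.E0 ≃ₐ[ℚ_[p]] ℰ.E0 => B) ν)⟩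

/-! ## 3. (5.2.5.4), last clause: `B̃_E = B ⊗_{ℚ_p} E` is a finite free `B`-module of rank `[E : ℚ_p]` -/

/-- `B ≠ 0` (it injects into the field `B_dR`). [folklore] -/
theorem _root_.Summit.ABC.IUTFork.Joshi.ATS3.PeriodRingTower.nontrivial_B (T : PeriodRingTower D p Ω) :
    Nontrivial B :=
  RingHom.domain_nontrivial T.toBdR.toRingHom

/-- (5.2.5.4) p.40 l.11–13 «`B̃_E = B ⊗_{ℚ_p} E` is naturally a … free `B`-module» — PROVED (base change of the free
`ℚ_p`-module `E`). [claim: Joshi2024ATS3, status: disputed] -/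
theorem btilde_free : Module.Free B ℰ.Btilde := inferInstance

/-- (5.2.5.4) p.40 l.11–13 «… a finite … `B`-module» — PROVED. [claim: Joshi2024ATS3, status: disputed] -/
theorem btilde_finite : Module.Finite B ℰ.Btilde := by
  haveI := ℰ.finiteDimensional
  unfold Btilde
  infer_instance

/-- Its `B`-rank is `[E : ℚ_p]` (`= e·f`, the total number of summands `B` hidden in (5.2.5.3)–(5.2.5.4)). PROVED.
[claim: Joshi2024ATS3, status: disputed] -/
theorem finrank_btilde : Module.finrank B ℰ.Btilde = Module.finrank ℚ_[p] ℰ.E := by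
  haveI := ℰ.finiteDimensional
  haveI := T.nontrivial_B
  unfold Btilde
  exact Module.finrank_baseChange

end BEDatum

end PeriodRingTower

end Summit.ABC.IUTFork.Joshi.ATS3

end
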